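import Mathlib
import HarnessLib
import Summits.HubbardSuperconductivity.HubbardSuperconductivity.Theorems.KLProgrammeC4aLoopIBP
import Summits.HubbardSuperconductivity.HubbardSuperconductivity.Theorems.KLProgrammeC4aLoopIBPJets

/-!
# Route `KLProgramme` — crux C4a, S3 (B4)-GENERIC — MONOTONE-WINDOW CALCULUS, part 3 («(B4)-GEN-WINDOW», the BOUNDS):
# `|(L_g^r w)^{(j)}| ≤ loopIBPTable (recipSlopeJet m G) W r j` on the window, `‖∫ w•Ψ^{(c)}(g)‖ ≤ T(c,0)·∫‖Ψ(g)‖`, and the monotone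
# substitution `∫_{a..b} u(g φ) dφ ≤ m⁻¹ · |∫_{g a..g b} u|`

Cell `gate-hubbard-kl`, seat hubbard-kl-k3c3-p3 (g20; row «implicit-function / monotonicity route»).  Located brick for the (C)-closer lane c4a-1
(stub (C) `stub_twoLeg_curvature` of `KLRegimeEngineV17F2`, stmt-HubbardSuperconductivity-20437), C4A-PLAN §24.4 (iii) / §24.6 (B4) / §24.10:
the generic-region window terms `∫ w(φ) • Ψ^{(c)}(ē(φ)) dφ` after `c` loop-angle integrations by parts (`…C4aLoopIBP`) are
`(−1)^c ∫ (L_ē^c w) • Ψ(ē)`; this module prices the weight.  INPUTS on the window `[a,b]` (all the consumer has by name): the slope floor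
`m ≤ |∂_φē|` (`…C4aPartnerBandCrossingSlopes`: `m = |T|/2` within `c₁|T|` of a crossing), the partner-band jets `|∂_φ^l ē| ≤ G l`, `2 ≤ l ≤ c+1`
(path jets `msD`/`msD6` ∘ band sizes `‖Dʲe_K‖ ≤ K_j`), and the weight jets `|w^{(l)}| ≤ W l`, `l ≤ c` (bump × Jacobian jets × anisotropy Bell factors).

* §1 **`abs_iteratedDeriv_inv_deriv_le`** — `|(1/∂_φē)^{(k)}| ≤ recipSlopeJet m G k` on `(a,b)` (`k ≤ c`): the implicit relation `(1/g′)·g′ ≡ 1` solved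
  order by order (`…C4aLoopIBPJets.abs_iteratedDeriv_inv_le_of_table`);
* §2 **`abs_iteratedDeriv_iterate_loopIBPOp_le`** — `|(L_g^r w)^{(j)}(x)| ≤ loopIBPTable (recipSlopeJet m G) W r j` for `x ∈ (a,b)`, `r + j ≤ c`
  (induction on `r`: `L_g^{r+1} w = (L_g^r w · (1/g′))′`, exact Leibniz on the open window); **`abs_iterate_loopIBPOp_le`** — everywhere (`= 0` off the window);
* §3 **`norm_intervalIntegral_smul_iteratedDeriv_comp_le`** — `‖∫_{a..b} w φ • Ψ^{(c)}(g φ) dφ‖ ≤ T(c,0) · ∫_{a..b} ‖Ψ(g φ)‖ dφ`;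
* §4 MONOTONE SUBSTITUTION (the row's device: on the window `φ ↦ g φ` is a diffeomorphism onto its image with `|dφ/dg| ≤ m⁻¹`):
  `intervalIntegral_comp_le_of_deriv_ge` (`g′ ≥ m`: `∫_{a..b} u(g φ) ≤ m⁻¹ ∫_{g a..g b} u`), `_of_deriv_le` (`g′ ≤ −m`), **`intervalIntegral_comp_le_of_abs_deriv_ge`**
  (`|g′| ≥ m`: `≤ m⁻¹·|∫_{g a..g b} u|`, sign fixed by connectedness), and the composite **`norm_intervalIntegral_smul_iteratedDeriv_comp_le_level`**:
  `‖∫_{a..b} w • Ψ^{(c)}(g)‖ ≤ T(c,0) · m⁻¹ · |∫_{g a..g b} ‖Ψ y‖ dy|` — a loop-angle window term is priced by a LEVEL integral of `‖Ψ‖` (no `Λ_n^{−(c+1)}`).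

Carrier-free (`g, w, u : ℝ → ℝ`, `Ψ : ℝ → E`); nothing is asserted about the Hubbard model.
References: FST II, CPAM 51 (1998) §3; BGM 2006 §2.4 [cite: BenfattoGiulianiMastropietro2006].
-/

noncomputable section

namespace Summit.HubbardSuperconductivity.HubbardSuperconductivity.Theorems.C4a

set_option linter.dupNamespace false -- summit = problem name (single-conjunct summit), D-0017

open Real Set Filter MeasureTheory intervalIntegral Finset
open scoped Topology

variable {E : Type*} [NormedAddCommGroup E] [NormedSpace ℝ E] [CompleteSpace E]

/-! ## §1 The reciprocal-slope jets on the window -/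

section Recip

variable {g : ℝ → ℝ} {a b m : ℝ} {c : ℕ} {G : ℕ → ℝ}

/-- A slope floor excludes critical points on the window. -/
theorem deriv_ne_zero_of_floor (hm : 0 < m) (hgm : ∀ s ∈ Icc a b, m ≤ |deriv g s|) : ∀ s ∈ Icc a b, deriv g s ≠ 0 :=
  fun s hs h0 => by have := hgm s hs; rw [h0, abs_zero] at this; exact absurd this (not_le.2 hm)

/-- **RECIPROCAL-SLOPE JETS**: `g ∈ C^{c+1}`, `m ≤ |g′|` on `[a,b]` (`0 < m`), `|g^{(l)}| ≤ G l` on `[a,b]` for `2 ≤ l ≤ c+1` ⟹ for every `k ≤ c` and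
`x ∈ (a,b)`, `|(1/g′)^{(k)}(x)| ≤ recipSlopeJet m G k`. [folklore] -/
theorem abs_iteratedDeriv_inv_deriv_le (hg : ContDiff ℝ (c + 1) g) (hm : 0 < m) (hgm : ∀ s ∈ Icc a b, m ≤ |deriv g s|)
    (hG : ∀ l, 2 ≤ l → l ≤ c + 1 → ∀ s ∈ Icc a b, |iteratedDeriv l g s| ≤ G l) :
    ∀ k ≤ c, ∀ x ∈ Ioo a b, |iteratedDeriv k (fun s => (deriv g s)⁻¹) x| ≤ recipSlopeJet m G k := by
  have hdg : ContDiff ℝ c (deriv g) := by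
    have h := hg.iterate_deriv' c 1
    simpa only [Function.iterate_one] using h
  refine abs_iteratedDeriv_inv_le_of_table isOpen_Ioo hdg.contDiffOn hm (fun x hx => hgm x (Ioo_subset_Icc_self hx))
    (Hb := fun l => G (l + 1)) (fun l hl1 hlN x hx => ?_) (le_of_eq (recipSlopeJet_zero m G).symm) (fun k hk1 hkN => ?_)
  · rw [← iteratedDeriv_succ']
    exact hG (l + 1) (by omega) (by omega) x (Ioo_subset_Icc_self hx)
  · obtain ⟨k', rfl⟩ : ∃ k', k = k' + 1 := ⟨k - 1, by omega⟩
    rw [recipSlopeJet_succ_range]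
    refine le_of_eq ?_
    congr 1
    refine Finset.sum_congr rfl fun j hj => ?_
    have hj' : j < k' + 1 := Finset.mem_range.1 hj
    have hidx : k' + 1 - j + 1 = k' + 2 - j := by omega
    simp only [hidx]

end Recip

/-! ## §2 The graded table for the iterated weight -/

section Table

variable {g w : ℝ → ℝ} {a b m : ℝ} {c : ℕ} {G W : ℕ → ℝ}

/-- **THE GRADED IBP TABLE**: `g ∈ C^{c+1}`, slope floor `m ≤ |g′|` and jets `|g^{(l)}| ≤ G l` (`2 ≤ l ≤ c+1`) on `[a,b]`, `w ∈ C^c` with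
`tsupport w ⊆ (a,b)` and `|w^{(l)}| ≤ W l` (`l ≤ c`) on `(a,b)` ⟹ for `r + j ≤ c` and `x ∈ (a,b)`,
`|(L_g^r w)^{(j)}(x)| ≤ loopIBPTable (recipSlopeJet m G) W r j`. [folklore] -/
theorem abs_iteratedDeriv_iterate_loopIBPOp_le (hg : ContDiff ℝ (c + 1) g) (hm : 0 < m) (hgm : ∀ s ∈ Icc a b, m ≤ |deriv g s|)
    (hG : ∀ l, 2 ≤ l → l ≤ c + 1 → ∀ s ∈ Icc a b, |iteratedDeriv l g s| ≤ G l)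
    (hw : ContDiff ℝ c w) (hsupp : tsupport w ⊆ Ioo a b) (hW : ∀ l ≤ c, ∀ s ∈ Ioo a b, |iteratedDeriv l w s| ≤ W l) :
    ∀ r j, r + j ≤ c → ∀ x ∈ Ioo a b, |iteratedDeriv j ((loopIBPOp g)^[r] w) x| ≤ loopIBPTable (recipSlopeJet m G) W r j := by
  have hg' := deriv_ne_zero_of_floor hm hgm
  have hdg : ContDiff ℝ c (deriv g) := by
    have h := hg.iterate_deriv' c 1
    simpa only [Function.iterate_one] using h
  have hq : ContDiffOn ℝ c (fun s => (deriv g s)⁻¹) (Ioo a b) :=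
    contDiffOn_inv_of_ne hdg.contDiffOn fun x hx => hg' x (Ioo_subset_Icc_self hx)
  have hQ := abs_iteratedDeriv_inv_deriv_le hg hm hgm hG
  intro r
  induction r with
  | zero =>
    intro j hj x hx
    rw [Function.iterate_zero_apply, loopIBPTable_zero]
    exact hW j (by simpa using hj) x hx
  | succ r ih =>
    intro j hj x hx
    -- `L_g^{r+1} w = (L_g^r w · (1/g′))′`
    set v : ℝ → ℝ := (loopIBPOp g)^[r] w with hv
    have hstep : (loopIBPOp g)^[r + 1] w = deriv (fun s => v s * (deriv g s)⁻¹) := by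
      rw [Function.iterate_succ_apply', loopIBPOp_def, div_deriv_eq_mul_inv]
    rw [hstep, ← iteratedDeriv_succ', loopIBPTable_succ]
    -- the class of `v` on the window
    have hvC : ContDiff ℝ (c - r : ℕ) v := contDiff_iterate_loopIBPOp hg hg' hw hsupp r (c - r) (by omega)
    have hmul := abs_iteratedDeriv_mul_le_on isOpen_Ioo (N := c - r) hvC.contDiffOn (hq.of_le (by exact_mod_cast Nat.sub_le c r))
      (k := j + 1) (by omega) hx (Fb := fun i => loopIBPTable (recipSlopeJet m G) W r i) (Gb := fun i => recipSlopeJet m G i)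
      (fun i hi => ih i (by omega) x hx) (fun i hi => hQ i (by omega) x hx)
    refine hmul.trans (le_of_eq (Finset.sum_congr rfl fun i _ => ?_))
    ring

/-- **THE ITERATED WEIGHT, EVERYWHERE**: under the same hypotheses plus `0 ≤ G`, `0 ≤ W`, for every `x : ℝ`,
`|(L_g^c w)(x)| ≤ loopIBPTable (recipSlopeJet m G) W c 0` (off the window the weight vanishes). [folklore] -/
theorem abs_iterate_loopIBPOp_le (hg : ContDiff ℝ (c + 1) g) (hm : 0 < m) (hgm : ∀ s ∈ Icc a b, m ≤ |deriv g s|)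
    (hG : ∀ l, 2 ≤ l → l ≤ c + 1 → ∀ s ∈ Icc a b, |iteratedDeriv l g s| ≤ G l) (hG0 : ∀ l, 0 ≤ G l)
    (hw : ContDiff ℝ c w) (hsupp : tsupport w ⊆ Ioo a b) (hW : ∀ l ≤ c, ∀ s ∈ Ioo a b, |iteratedDeriv l w s| ≤ W l) (hW0 : ∀ l, 0 ≤ W l)
    (x : ℝ) : |(loopIBPOp g)^[c] w x| ≤ loopIBPTable (recipSlopeJet m G) W c 0 := by
  by_cases hx : x ∈ Ioo a b
  · have h := abs_iteratedDeriv_iterate_loopIBPOp_le hg hm hgm hG hw hsupp hW c 0 (by simp) x hx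
    simpa only [iteratedDeriv_zero] using h
  · rw [iterate_loopIBPOp_apply_eq_zero hsupp c hx, abs_zero]
    exact loopIBPTable_nonneg (recipSlopeJet_nonneg hm.le hG0) hW0 c 0

end Table

/-! ## §3 The window term priced by `∫ ‖Ψ ∘ g‖` -/

section Integral

variable {g w : ℝ → ℝ} {a b m : ℝ} {c : ℕ} {G W : ℕ → ℝ}

/-- **THE WINDOW TERM**: `a ≤ b`, the hypotheses of `abs_iterate_loopIBPOp_le`, `Ψ ∈ C^c` ⟹
`‖∫_{a..b} w φ • Ψ^{(c)}(g φ) dφ‖ ≤ loopIBPTable (recipSlopeJet m G) W c 0 · ∫_{a..b} ‖Ψ(g φ)‖ dφ`. [folklore] -/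
theorem norm_intervalIntegral_smul_iteratedDeriv_comp_le (hab : a ≤ b) (hg : ContDiff ℝ (c + 1) g) (hm : 0 < m)
    (hgm : ∀ s ∈ Icc a b, m ≤ |deriv g s|) (hG : ∀ l, 2 ≤ l → l ≤ c + 1 → ∀ s ∈ Icc a b, |iteratedDeriv l g s| ≤ G l) (hG0 : ∀ l, 0 ≤ G l)
    (hw : ContDiff ℝ c w) (hsupp : tsupport w ⊆ Ioo a b) (hW : ∀ l ≤ c, ∀ s ∈ Ioo a b, |iteratedDeriv l w s| ≤ W l) (hW0 : ∀ l, 0 ≤ W l)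
    {Ψ : ℝ → E} (hΨ : ContDiff ℝ c Ψ) :
    ‖∫ φ in a..b, w φ • iteratedDeriv c Ψ (g φ)‖ ≤ loopIBPTable (recipSlopeJet m G) W c 0 * ∫ φ in a..b, ‖Ψ (g φ)‖ := by
  have hg' := deriv_ne_zero_of_floor hm hgm
  set T := loopIBPTable (recipSlopeJet m G) W c 0 with hT
  rw [intervalIntegral_smul_iteratedDeriv_comp_eq c hg hg' hw hsupp hΨ, norm_smul, norm_pow, norm_neg, norm_one, one_pow, one_mul]
  have hLc : Continuous ((loopIBPOp g)^[c] w) := continuous_iterate_loopIBPOp c hg hg' hw hsupp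
  have hΨg : Continuous fun φ => Ψ (g φ) := (hΨ.continuous).comp hg.continuous
  calc ‖∫ φ in a..b, (loopIBPOp g)^[c] w φ • Ψ (g φ)‖
      ≤ ∫ φ in a..b, ‖(loopIBPOp g)^[c] w φ • Ψ (g φ)‖ := intervalIntegral.norm_integral_le_integral_norm hab
    _ ≤ ∫ φ in a..b, T * ‖Ψ (g φ)‖ := by
        refine intervalIntegral.integral_mono_on hab ((hLc.smul hΨg).norm.intervalIntegrable a b)
          ((hΨg.norm.const_mul T).intervalIntegrable a b) fun φ _ => ?_
        rw [norm_smul, Real.norm_eq_abs]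
        exact mul_le_mul_of_nonneg_right (abs_iterate_loopIBPOp_le hg hm hgm hG hG0 hw hsupp hW hW0 φ) (norm_nonneg _)
    _ = T * ∫ φ in a..b, ‖Ψ (g φ)‖ := intervalIntegral.integral_const_mul T _

end Integral

/-! ## §4 Monotone substitution: loop-angle integrals of functions of the level are level integrals -/

section Substitution

variable {g u : ℝ → ℝ} {a b m : ℝ}

/-- **MONOTONE SUBSTITUTION, INCREASING**: `a ≤ b`, `g ∈ C¹`, `m ≤ g′` on `[a,b]` (`0 < m`), `u ≥ 0` continuous ⟹
`∫_{a..b} u(g φ) dφ ≤ m⁻¹ · ∫_{g a..g b} u(y) dy` (`dφ = dy/g′(φ) ≤ dy/m`). [folklore] -/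
theorem intervalIntegral_comp_le_of_deriv_ge (hab : a ≤ b) (hg : ContDiff ℝ 1 g) (hm : 0 < m) (hgm : ∀ x ∈ Icc a b, m ≤ deriv g x)
    (hu : Continuous u) (hu0 : ∀ y, 0 ≤ u y) :
    ∫ x in a..b, u (g x) ≤ m⁻¹ * ∫ y in g a..g b, u y := by
  have hgd : ∀ x, HasDerivAt g (deriv g x) x := fun x => ((hg.differentiable one_ne_zero) x).hasDerivAt
  have hgc' : Continuous (deriv g) := hg.continuous_deriv le_rfl
  have hsub : ∫ x in a..b, (u ∘ g) x * deriv g x = ∫ y in g a..g b, u y :=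
    intervalIntegral.integral_comp_mul_deriv (fun x _ => hgd x) hgc'.continuousOn hu
  rw [← hsub, ← intervalIntegral.integral_const_mul]
  refine intervalIntegral.integral_mono_on hab ((hu.comp hg.continuous).intervalIntegrable a b)
    (((hu.comp hg.continuous).mul hgc').const_mul m⁻¹ |>.intervalIntegrable a b) fun x hx => ?_
  have hm0 : m ≠ 0 := hm.ne'
  have h1 : u (g x) = m⁻¹ * (u (g x) * m) := by
    rw [mul_comm (u (g x)) m, ← mul_assoc, inv_mul_cancel₀ hm0, one_mul]
  rw [h1, Function.comp_apply]
  exact mul_le_mul_of_nonneg_left (mul_le_mul_of_nonneg_left (hgm x hx) (hu0 _)) (inv_nonneg.2 hm.le)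

/-- **MONOTONE SUBSTITUTION, DECREASING**: `a ≤ b`, `g ∈ C¹`, `g′ ≤ −m` on `[a,b]` (`0 < m`), `u ≥ 0` continuous ⟹
`∫_{a..b} u(g φ) dφ ≤ m⁻¹ · ∫_{g b..g a} u(y) dy`. [folklore] -/
theorem intervalIntegral_comp_le_of_deriv_le (hab : a ≤ b) (hg : ContDiff ℝ 1 g) (hm : 0 < m) (hgm : ∀ x ∈ Icc a b, deriv g x ≤ -m)
    (hu : Continuous u) (hu0 : ∀ y, 0 ≤ u y) :
    ∫ x in a..b, u (g x) ≤ m⁻¹ * ∫ y in g b..g a, u y := by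
  -- apply the increasing case to `−g` and `u ∘ (−·)`
  have hng : ContDiff ℝ 1 (-g) := hg.neg
  have hngm : ∀ x ∈ Icc a b, m ≤ deriv (-g) x := fun x hx => by
    rw [deriv.neg]; linarith [hgm x hx]
  have hun : Continuous fun y => u (-y) := hu.comp continuous_neg
  have h := intervalIntegral_comp_le_of_deriv_ge (u := fun y => u (-y)) hab hng hm hngm hun (fun y => hu0 _)
  simp only [Pi.neg_apply, neg_neg] at h
  rwa [intervalIntegral.integral_comp_neg u, neg_neg, neg_neg] at h

/-- **MONOTONE SUBSTITUTION, SIGN-FREE**: `a ≤ b`, `g ∈ C¹`, `m ≤ |g′|` on `[a,b]` (`0 < m`), `u ≥ 0` continuous ⟹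
`∫_{a..b} u(g φ) dφ ≤ m⁻¹ · |∫_{g a..g b} u(y) dy|` (the slope keeps one sign on the connected window). [folklore] -/
theorem intervalIntegral_comp_le_of_abs_deriv_ge (hab : a ≤ b) (hg : ContDiff ℝ 1 g) (hm : 0 < m) (hgm : ∀ x ∈ Icc a b, m ≤ |deriv g x|)
    (hu : Continuous u) (hu0 : ∀ y, 0 ≤ u y) :
    ∫ x in a..b, u (g x) ≤ m⁻¹ * |∫ y in g a..g b, u y| := by
  have hgc' : Continuous (deriv g) := hg.continuous_deriv le_rfl
  have hne : ∀ x ∈ Icc a b, deriv g x ≠ 0 := deriv_ne_zero_of_floor hm hgm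
  -- the slope has a constant sign on `[a,b]`
  by_cases hpos : 0 < deriv g a
  · have hall : ∀ x ∈ Icc a b, m ≤ deriv g x := by
      intro x hx
      have hx0 : 0 < deriv g x := by
        rcases lt_or_ge 0 (deriv g x) with h0 | hle
        · exact h0
        exfalso
        -- intermediate value on `[a,x]` would give a zero of `g′`
        have hax : a ≤ x := hx.1
        have hivt : (0 : ℝ) ∈ Icc (deriv g x) (deriv g a) := ⟨hle, hpos.le⟩
        obtain ⟨z, hz, hz0⟩ := intermediate_value_Icc' hax hgc'.continuousOn hivt
        exact hne z ⟨hz.1, hz.2.trans hx.2⟩ hz0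
      have := hgm x hx
      rwa [abs_of_pos hx0] at this
    refine (intervalIntegral_comp_le_of_deriv_ge hab hg hm hall hu hu0).trans ?_
    exact mul_le_mul_of_nonneg_left (le_abs_self _) (inv_nonneg.2 hm.le)
  · have ha0 : deriv g a < 0 := lt_of_le_of_ne (not_lt.1 hpos) (hne a (left_mem_Icc.2 hab))
    have hall : ∀ x ∈ Icc a b, deriv g x ≤ -m := by
      intro x hx
      have hx0 : deriv g x < 0 := by
        rcases lt_or_ge (deriv g x) 0 with h0 | hle
        · exact h0
        exfalso
        have hax : a ≤ x := hx.1
        have hivt : (0 : ℝ) ∈ Icc (deriv g a) (deriv g x) := ⟨ha0.le, hle⟩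
        obtain ⟨z, hz, hz0⟩ := intermediate_value_Icc hax hgc'.continuousOn hivt
        exact hne z ⟨hz.1, hz.2.trans hx.2⟩ hz0
      have := hgm x hx
      rw [abs_of_neg hx0] at this
      linarith
    refine (intervalIntegral_comp_le_of_deriv_le hab hg hm hall hu hu0).trans ?_
    rw [intervalIntegral.integral_symm (g a) (g b)]
    exact mul_le_mul_of_nonneg_left (neg_le_abs _) (inv_nonneg.2 hm.le)

end Substitution

/-! ## §5 The window term priced by a LEVEL integral -/

section Level

variable {g w : ℝ → ℝ} {a b m : ℝ} {c : ℕ} {G W : ℕ → ℝ}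

/-- **THE WINDOW TERM IN LEVEL CURRENCY**: `a ≤ b`, `g ∈ C^{c+1}`, slope floor `m ≤ |g′|` and jets `|g^{(l)}| ≤ G l` (`2 ≤ l ≤ c+1`, `0 ≤ G`) on
`[a,b]`, `w ∈ C^c`, `tsupport w ⊆ (a,b)`, `|w^{(l)}| ≤ W l` (`l ≤ c`, `0 ≤ W`), `Ψ ∈ C^c` ⟹
`‖∫_{a..b} w φ • Ψ^{(c)}(g φ) dφ‖ ≤ loopIBPTable (recipSlopeJet m G) W c 0 · m⁻¹ · |∫_{g a..g b} ‖Ψ y‖ dy|` — NO derivative of `Ψ` and NO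
power of the shell width beyond the level integral of `‖Ψ‖` itself. [folklore] -/
theorem norm_intervalIntegral_smul_iteratedDeriv_comp_le_level (hab : a ≤ b) (hg : ContDiff ℝ (c + 1) g) (hm : 0 < m)
    (hgm : ∀ s ∈ Icc a b, m ≤ |deriv g s|) (hG : ∀ l, 2 ≤ l → l ≤ c + 1 → ∀ s ∈ Icc a b, |iteratedDeriv l g s| ≤ G l) (hG0 : ∀ l, 0 ≤ G l)
    (hw : ContDiff ℝ c w) (hsupp : tsupport w ⊆ Ioo a b) (hW : ∀ l ≤ c, ∀ s ∈ Ioo a b, |iteratedDeriv l w s| ≤ W l) (hW0 : ∀ l, 0 ≤ W l)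
    {Ψ : ℝ → E} (hΨ : ContDiff ℝ c Ψ) :
    ‖∫ φ in a..b, w φ • iteratedDeriv c Ψ (g φ)‖ ≤
      loopIBPTable (recipSlopeJet m G) W c 0 * (m⁻¹ * |∫ y in g a..g b, ‖Ψ y‖|) := by
  refine (norm_intervalIntegral_smul_iteratedDeriv_comp_le hab hg hm hgm hG hG0 hw hsupp hW hW0 hΨ).trans ?_
  refine mul_le_mul_of_nonneg_left ?_ (loopIBPTable_nonneg (recipSlopeJet_nonneg hm.le hG0) hW0 c 0)
  exact intervalIntegral_comp_le_of_abs_deriv_ge (u := fun y => ‖Ψ y‖) hab (hg.of_le (by exact_mod_cast (by omega : 1 ≤ c + 1)))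
    hm hgm (hΨ.continuous.norm) (fun y => norm_nonneg _)

end Level

end Summit.HubbardSuperconductivity.HubbardSuperconductivity.Theorems.C4a

end
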